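import Summits.CriticalPhenomena.PercolationContinuityZ3.Theorems.Transplant.SiteSetExplorationHK
import Summits.CriticalPhenomena.PercolationContinuityZ3.Theorems.Transplant.SiteVdBHKTwoSet
import Summits.CriticalPhenomena.PercolationContinuityZ3.Theorems.Transplant.SiteCovTransferSet
import Summits.CriticalPhenomena.PercolationContinuityZ3.Theorems.PercNearOneGluingNoHeavyLowerTailCovTauStarBridge
import HarnessLib

/-!
# SITE percolation: the one-source bound (★^H)_site, part 1 — functionals on finite configurations, the Markov bookkeeping of
# the hybrid along the site exploration, and the site vdBHK Theorem 1.4 with a marker SET in finitary form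
# (WP3 step 2 of P1-SITE-Z3 §16; site twin of `Theorems/PercNearOneGluingNoHeavyLowerTailCovTauStarHPrelim.lean`)

builds on p205010 (kernel theorem, internal audit signed; external expert review pending).

Coordinates are VERTICES: a configuration is the finite set `K ⊆ D` of open vertices of the world `D : Finset V`, weights
`wtW D p K`, expectation `DecisionTree.ED D p`.  Objects (all OURS — the printed theorems are bond-only):
* `fS Γ W g x K = g(C^W_x(K))` (`SiteBHK.sC`, the site cluster of `x` inside the sub-world `W`), `nS Γ W S v K = 1{v ↔ S in W}`
  (some marker of `S` lies in `C^W_v`), `covS Γ D p g x S v W = Cov(g(C^W_x), 1{v ↔ S in W})` (the world functional `H` read in the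
  sub-world `W`), `yS Γ D p g x S v N = E[ H(D ∖ S_N(K)) ; x ∉ C_N ]` with `S_N(K)` the set revealed by the site exploration of the
  cluster of the source set `N` (`SiteSetExploration.revealedAt`, p213366/p213473: sources ∪ cluster ∪ vertex boundary);
* `sC_splice_of_mem_reached` — inside the explored cluster the hybrid `K →_{S_N(K)} K₂` has the clusters of `K`;
* `starS_markov` — the five Markov facts of the bond proof (`CovTauStarN.starH_markov`) in site form; no hypothesis `v ∉ S` is
  needed (the site world deletes the explored cluster, so `1{v ↔ S}` vanishes in it when `v ∈ C_N`);
* `bhk14S_ED` — SITE vdBHK Thm 1.4 with the marker set `S ∋ x` (`SiteBHK3.siteTwoSet_negCorrelation`, p209295) on the coordinates `D`;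
* `nS_union_eq` — `1{v ↔ S ∪ N} = 1{v ↔ S} + 1{v ↮ S}·1{v ↔ N}`.
Definitions + proofs (`--supports stmt-CriticalPhenomena-4575 --as helper`); no named facts, no sorries.
[cite: VandenbergHaggstromKahn2005, Thm. 1.4 (p. 7) with Remark 1 (p. 5), eq. (6) (p. 4)] [cite: Gladkov2024, Lemma 3.1, Thm. 3.2 (p. 4)]
-/

noncomputable section

open Classical

namespace Summit.CriticalPhenomena.PercolationContinuityZ3.Theorems.Transplant

namespace SiteStarH

open Finset MeasureTheory
open Literature.Probability.Percolation
open Literature.Probability.Percolation.DecisionTree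
open Literature.Probability.LatticeModels (prodBernoulli)
open SiteBHK (sC sD mem_sC_comm sC_mono)
open SiteSetExploration
open TreeHarris
open CovTauStarN (ED_congr_on ED_sub ED_univ_eq_ED_of_zero setIntegral_eq_ED measureReal_eq_ED)

variable {V : Type*} [Fintype V] [DecidableEq V] {Γ : SimpleGraph V}

/-! ### Inside the explored cluster the hybrid changes nothing -/

omit [Fintype V] [DecidableEq V] in
/-- Reachability transfer along a set closed under the first graph's edges, which are edges of the second graph there. [folklore] -/
theorem reachable_transfer {G₁ G₂ : SimpleGraph V} {W : Set V}
    (hcl : ∀ a b, a ∈ W → G₁.Adj a b → b ∈ W ∧ G₂.Adj a b) {u y : V} (hu : u ∈ W) (h : G₁.Reachable u y) :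
    y ∈ W ∧ G₂.Reachable u y := by
  rw [SimpleGraph.reachable_iff_reflTransGen] at h
  induction h with
  | refl => exact ⟨hu, SimpleGraph.Reachable.refl u⟩
  | tail _ hbc ih =>
    obtain ⟨hb, hub⟩ := ih
    obtain ⟨hc, hbc'⟩ := hcl _ _ hb hbc
    exact ⟨hc, hub.trans hbc'.reachable⟩

omit [Fintype V] in
/-- **Inside the explored cluster nothing changes (site)**: for a reached vertex `v ∈ C_N(K₁)` the hybrid `K₁ →_{S_N(K₁)} K₂` has the
same site cluster of `v` inside `D` as `K₁` (the `D`-neighbours of reached vertices are revealed, and open revealed vertices are reached).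
[cite: VandenbergHaggstromKahn2005, eq. (6) (p. 4)] [cite: Gladkov2024, Lemma 3.1] -/
theorem sC_splice_of_mem_reached {D N K₁ : Finset V} (K₂ : Finset V) {v : V} (hv : v ∈ reached Γ D N K₁) :
    sC Γ D v (↑(splice (revealedAt Γ D N K₁) K₁ K₂) : Set V) = sC Γ D v (↑K₁ : Set V) := by
  set R := revealedAt Γ D N K₁ with hR
  set H := splice R K₁ K₂ with hH
  have hagree : ∀ a ∈ reached Γ D N K₁, (a ∈ H ↔ a ∈ K₁) := fun a ha => splice_agree R K₁ K₂ a (mem_of_mem_reached ha).1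
  -- closure of the reached set under the open edges of `K₁`, which are open edges of the hybrid
  have hcl₁ : ∀ a b, a ∈ (↑(reached Γ D N K₁) : Set V) → (siteOpenGraph Γ ((↑K₁ : Set V) ∩ ↑D)).Adj a b →
      b ∈ (↑(reached Γ D N K₁) : Set V) ∧ (siteOpenGraph Γ ((↑H : Set V) ∩ ↑D)).Adj a b := by
    intro a b ha hab
    have ha' : a ∈ reached Γ D N K₁ := mem_coe.1 ha
    obtain ⟨hadj, ⟨haK, haD⟩, ⟨hbK, hbD⟩⟩ := SiteBHK.adj_iff.1 hab
    have hb : b ∈ reached Γ D N K₁ :=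
      mem_reached_of_mem_revealedAt (mem_rev_of_adj ha' (mem_coe.1 hbD) hadj) (mem_coe.1 hbK)
    exact ⟨mem_coe.2 hb, SiteBHK.adj_iff.2 ⟨hadj, ⟨mem_coe.2 ((hagree a ha').2 (mem_coe.1 haK)), haD⟩,
      ⟨mem_coe.2 ((hagree b hb).2 (mem_coe.1 hbK)), hbD⟩⟩⟩
  -- and conversely
  have hcl₂ : ∀ a b, a ∈ (↑(reached Γ D N K₁) : Set V) → (siteOpenGraph Γ ((↑H : Set V) ∩ ↑D)).Adj a b →
      b ∈ (↑(reached Γ D N K₁) : Set V) ∧ (siteOpenGraph Γ ((↑K₁ : Set V) ∩ ↑D)).Adj a b := by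
    intro a b ha hab
    have ha' : a ∈ reached Γ D N K₁ := mem_coe.1 ha
    obtain ⟨hadj, ⟨haH, haD⟩, ⟨hbH, hbD⟩⟩ := SiteBHK.adj_iff.1 hab
    have hbR : b ∈ R := mem_rev_of_adj ha' (mem_coe.1 hbD) hadj
    have hbK : b ∈ K₁ := (splice_agree R K₁ K₂ b hbR).1 (mem_coe.1 hbH)
    have hb : b ∈ reached Γ D N K₁ := mem_reached_of_mem_revealedAt hbR hbK
    exact ⟨mem_coe.2 hb, SiteBHK.adj_iff.2 ⟨hadj, ⟨mem_coe.2 (mem_of_mem_reached ha').2, haD⟩, ⟨mem_coe.2 hbK, hbD⟩⟩⟩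
  have hv0 : v ∈ (↑(reached Γ D N K₁) : Set V) := mem_coe.2 hv
  have hvK : v ∈ K₁ := (mem_of_mem_reached hv).2
  have hvH : v ∈ H := (hagree v hv).2 hvK
  ext y
  constructor
  · rintro ⟨⟨-, hvD⟩, ⟨-, hyD⟩, hr⟩
    obtain ⟨hy, hr'⟩ := reachable_transfer hcl₂ hv0 hr
    exact ⟨⟨mem_coe.2 hvK, hvD⟩, ⟨mem_coe.2 (mem_of_mem_reached (mem_coe.1 hy)).2, hyD⟩, hr'⟩
  · rintro ⟨⟨-, hvD⟩, ⟨-, hyD⟩, hr⟩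
    obtain ⟨hy, hr'⟩ := reachable_transfer hcl₁ hv0 hr
    have hy' : y ∈ reached Γ D N K₁ := mem_coe.1 hy
    exact ⟨⟨mem_coe.2 hvH, hvD⟩, ⟨mem_coe.2 ((hagree y hy').2 (mem_of_mem_reached hy').2), hyD⟩, hr'⟩

/-! ### The functionals on finite configurations -/

variable (Γ)

/-- `g(C^W_x)` as a function of the finite configuration (site cluster of `x` inside the sub-world `W`).
[cite: VandenbergHaggstromKahn2005, §1 p. 3 (`C_s`), p. 4 (the induced model on the rest)] -/
def fS (W : Finset V) (g : Set V → ℝ) (x : V) (K : Finset V) : ℝ := g (sC Γ W x (↑K : Set V))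

/-- `1{v ↔ S in W}`: some marker of `S` lies in the site cluster of `v` inside `W`. [cite: VandenbergHaggstromKahn2005, §1 p. 3] -/
def nS (W : Finset V) (S : Finset V) (v : V) (K : Finset V) : ℝ :=
  ind {L : Finset V | ∃ s ∈ S, s ∈ sC Γ W v (↑L : Set V)} K

/-- **`H(W) = Cov(g(C^W_x), 1{v ↔ S in W})`** on the coordinates `D` with weights `p` (the world functional read in the sub-world `W`;
total mass one, so no denominator). [cite: VandenbergHaggstromKahn2005, Thm. 1.5 eq. (9) (p. 7)] -/
def covS (D : Finset V) (p : V → ℝ) (g : Set V → ℝ) (x : V) (S : Finset V) (v : V) (W : Finset V) : ℝ :=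
  ED D p (fun K => fS Γ W g x K * nS Γ W S v K) - ED D p (fS Γ W g x) * ED D p (nS Γ W S v)

/-- **`Y^H(N) = E[ H(D ∖ S_N) ; x ∉ C_N ]`** — the averaged world covariance outside the explored site cluster of `N`, on the event that
`x` is not swallowed by it. [cite: VandenbergHaggstromKahn2005, eq. (6) (p. 4)] -/
def yS (D : Finset V) (p : V → ℝ) (g : Set V → ℝ) (x : V) (S : Finset V) (v : V) (N : Finset V) : ℝ :=
  ED D p (fun K => ind {L : Finset V | x ∉ reached Γ D N L} K * covS Γ D p g x S v (D \ revealedAt Γ D N K))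

variable {Γ}

omit [Fintype V] [DecidableEq V] in
/-- `fS` is monotone for monotone `g`. [folklore] -/
theorem fS_mono (W : Finset V) {g : Set V → ℝ} (hg : Monotone g) (x : V) : Monotone (fS Γ W g x) :=
  fun _ _ h => hg (sC_mono W x (Finset.coe_subset.2 h))

omit [Fintype V] [DecidableEq V] in
/-- `0 ≤ nS ≤ 1`. [folklore] -/
theorem nS_nonneg_le_one (W S : Finset V) (v : V) (K : Finset V) : 0 ≤ nS Γ W S v K ∧ nS Γ W S v K ≤ 1 :=
  ⟨ind_nonneg _ _, BHK2006.ind_le_one _ _⟩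

omit [Fintype V] [DecidableEq V] in
/-- `{v ↔ S in W}` is an increasing event. [folklore] -/
theorem isUpperSet_nS (W S : Finset V) (v : V) : IsUpperSet {L : Finset V | ∃ s ∈ S, s ∈ sC Γ W v (↑L : Set V)} :=
  fun _ _ h ⟨s, hs, hsC⟩ => ⟨s, hs, sC_mono W v (Finset.coe_subset.2 h) hsC⟩

omit [Fintype V] in
/-- `1{v ↔ S ∪ N} = 1{v ↔ S} + 1{v ↮ S}·1{v ↔ N}`. [folklore] -/
theorem nS_union_eq (W S N : Finset V) (v : V) (K : Finset V) :
    nS Γ W (S ∪ N) v K = nS Γ W S v K + (1 - nS Γ W S v K) * nS Γ W N v K := by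
  unfold nS
  by_cases h1 : ∃ s ∈ S, s ∈ sC Γ W v (↑K : Set V)
  · rw [ind_of_mem (show K ∈ {L : Finset V | ∃ s ∈ S, s ∈ sC Γ W v (↑L : Set V)} from h1),
      ind_of_mem (show K ∈ {L : Finset V | ∃ s ∈ S ∪ N, s ∈ sC Γ W v (↑L : Set V)} from by
        obtain ⟨s, hs, h⟩ := h1; exact ⟨s, Finset.mem_union_left _ hs, h⟩)]
    ring
  · rw [ind_of_not_mem (show K ∉ {L : Finset V | ∃ s ∈ S, s ∈ sC Γ W v (↑L : Set V)} from h1)]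
    by_cases h2 : ∃ s ∈ N, s ∈ sC Γ W v (↑K : Set V)
    · rw [ind_of_mem (show K ∈ {L : Finset V | ∃ s ∈ N, s ∈ sC Γ W v (↑L : Set V)} from h2),
        ind_of_mem (show K ∈ {L : Finset V | ∃ s ∈ S ∪ N, s ∈ sC Γ W v (↑L : Set V)} from by
          obtain ⟨s, hs, h⟩ := h2; exact ⟨s, Finset.mem_union_right _ hs, h⟩)]
      ring
    · rw [ind_of_not_mem (show K ∉ {L : Finset V | ∃ s ∈ N, s ∈ sC Γ W v (↑L : Set V)} from h2),
        ind_of_not_mem (show K ∉ {L : Finset V | ∃ s ∈ S ∪ N, s ∈ sC Γ W v (↑L : Set V)} from by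
          rintro ⟨s, hs, h⟩
          rcases Finset.mem_union.1 hs with hs | hs
          · exact h1 ⟨s, hs, h⟩
          · exact h2 ⟨s, hs, h⟩)]
      ring

omit [Fintype V] in
/-- `1{v ↔ N in D}(K) = 1{v ∈ C_N(K)}`: the marker set `N` meets the cluster of `v` iff `v` is reached by the exploration of `C_N`. [folklore] -/
theorem nS_eq_ind_reached (D N : Finset V) (v : V) (K : Finset V) :
    nS Γ D N v K = ind {L : Finset V | v ∈ reached Γ D N L} K := by
  unfold nS
  refine BystanderBHK.ind_congr ?_
  simp only [Set.mem_setOf_eq, mem_reached_iff]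
  exact exists_congr fun s => and_congr_right fun _ => mem_sC_comm

/-! ### Markov bookkeeping along the site exploration -/

omit [Fintype V] in
/-- MARKOV BOOKKEEPING for (★^H)_site: along the site exploration of `C_N(K)`, for every `K₂`, the hybrid `K →_{S_N(K)} K₂` has
(i) for `x ∈ C_N`: the owner's functional of `K`; (ii) for `x ∉ C_N`: the owner's functional of `K₂` read in the site world `D ∖ S_N(K)`;
(iii) for `v ∈ C_N`: the indicator `1{v ↔ S}` of `K`; (iv) for `v ∉ C_N`: the indicator of `K₂` read in the site world; and (v) for
`v ∈ C_N` the world indicator vanishes (`v` is dead there).  No hypothesis `v ∉ S`. [cite: VandenbergHaggstromKahn2005, eq. (6) (p. 4)] -/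
theorem starS_markov {D N : Finset V} (x v : V) (S : Finset V) (g : Set V → ℝ) (K K₂ : Finset V) :
    (x ∈ reached Γ D N K → fS Γ D g x (splice (revealedAt Γ D N K) K K₂) = fS Γ D g x K) ∧
    (x ∉ reached Γ D N K → fS Γ D g x (splice (revealedAt Γ D N K) K K₂) = fS Γ (D \ revealedAt Γ D N K) g x K₂) ∧
    (v ∈ reached Γ D N K → nS Γ D S v (splice (revealedAt Γ D N K) K K₂) = nS Γ D S v K) ∧
    (v ∉ reached Γ D N K → nS Γ D S v (splice (revealedAt Γ D N K) K K₂) = nS Γ (D \ revealedAt Γ D N K) S v K₂) ∧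
    (v ∈ reached Γ D N K → nS Γ (D \ revealedAt Γ D N K) S v K₂ = 0) := by
  refine ⟨fun hx => ?_, fun hx => ?_, fun hv => ?_, fun hv => ?_, fun hv => ?_⟩
  · simp only [fS, sC_splice_of_mem_reached K₂ hx]
  · simp only [fS, sC_splice_of_not_mem_reached hx]
  · unfold nS
    refine BystanderBHK.ind_congr ?_
    simp only [Set.mem_setOf_eq, sC_splice_of_mem_reached K₂ hv]
  · unfold nS
    refine BystanderBHK.ind_congr ?_
    simp only [Set.mem_setOf_eq, sC_splice_of_not_mem_reached hv]
  · refine ind_of_not_mem ?_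
    rintro ⟨s, -, hs⟩
    have hvD : v ∉ D \ revealedAt Γ D N K := fun h => (Finset.mem_sdiff.1 h).2 (mem_of_mem_reached hv).1
    rw [sC_eq_empty_of_notMem_U hvD] at hs
    exact hs

/-! ### SITE vdBHK Theorem 1.4 with the marker set `S`, finitary, on the coordinates `D` -/

omit [Fintype V] [DecidableEq V] in
/-- For `K ⊆ D` the cluster inside `D` is the plain site cluster of the configuration `K`. [folklore] -/
theorem sC_coe_eq_siteCluster {D K : Finset V} (hK : K ⊆ D) (s : V) : sC Γ D s (↑K : Set V) = siteCluster Γ (↑K : Set V) s := by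
  have h : (↑K : Set V) ∩ ↑D = ↑K := Set.inter_eq_left.2 (Finset.coe_subset.2 hK)
  simp only [sC, h]
  rfl

/-- **SITE vdBHK Thm 1.4 with the marker set `S ∋ x`, finitary, on the coordinates `D`**: given `S ↮ v`, `g(C_x)` and `1{v ↔ N}` are
negatively correlated: `P(v↮S)·E[g(C_x) 1{v↔N}; v↮S] ≤ E[1{v↔N}; v↮S]·E[g(C_x); v↮S]` (OURS; from `SiteBHK3.siteTwoSet_negCorrelation`,
the cluster of `x` being read inside `C_S`). [cite: VandenbergHaggstromKahn2005, Thm. 1.4 (p. 7) with Remark 1 (p. 5)] -/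
theorem bhk14S_ED (D : Finset V) {p : V → ℝ} (hp0 : ∀ u, 0 ≤ p u) (hp1 : ∀ u, p u ≤ 1)
    (N : Finset V) (x v : V) (S : Finset V) (hxS : x ∈ S) (g : Set V → ℝ) (hg : Monotone g) :
    ED D p (fun K => 1 - nS Γ D S v K) * ED D p (fun K => fS Γ D g x K * ((1 - nS Γ D S v K) * nS Γ D N v K)) ≤
      ED D p (fun K => (1 - nS Γ D S v K) * nS Γ D N v K) * ED D p (fun K => fS Γ D g x K * (1 - nS Γ D S v K)) := by
  set w : V → unitInterval := fun u => if u ∈ D then ⟨max 0 (min 1 (p u)), by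
    exact ⟨le_max_left _ _, max_le zero_le_one (min_le_left _ _)⟩⟩ else 0 with hw
  have hwD : ∀ u ∈ D, ((w u : unitInterval) : ℝ) = p u := fun u hu => by
    simp only [hw, if_pos hu]
    rw [min_eq_right (hp1 u), max_eq_right (hp0 u)]
  have hwD' : ∀ u ∉ D, ((w u : unitInterval) : ℝ) = 0 := fun u hu => by simp only [hw, if_neg hu]; rfl
  have hED : ∀ φ : Finset V → ℝ, ED Finset.univ (fun u => (w u : ℝ)) φ = ED D p φ :=
    fun φ => ED_univ_eq_ED_of_zero D p _ hwD hwD' φ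
  -- the increasing test functions: `g(C_x)` read inside `C_S`, and `1{N ∩ C_v ≠ ∅}`
  set F : Set V → ℝ := fun C => g (siteCluster Γ C x) with hF
  have hFmono : Monotone F := fun C C' h => hg (SiteGen.siteCluster_mono' Γ x h)
  set G : Set V → ℝ := fun C => if (∃ s ∈ N, s ∈ C) then 1 else 0 with hG
  have hGmono : Monotone G := by
    intro C C' hCC'
    simp only [hG]
    by_cases h : ∃ s ∈ N, s ∈ C
    · rw [if_pos h, if_pos (h.imp fun s ⟨hs, hsC⟩ => ⟨hs, hCC' hsC⟩)]
    · rw [if_neg h]; split_ifs <;> norm_num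
  have key := SiteBHK3.siteTwoSet_negCorrelation (Γ := Γ) w (↑S : Set V) {v} F G hFmono hGmono
  set D0 : Set (Set V) := {ω | ∀ s ∈ (↑S : Set V), ∀ t ∈ ({v} : Set V), t ∉ siteCluster Γ ω s} with hD0
  -- dictionary on the configurations `K ⊆ D`
  have hind : ∀ K ∈ D.powerset, ind D0 (↑K : Set V) = 1 - nS Γ D S v K := by
    intro K hK
    have hK' := Finset.mem_powerset.1 hK
    unfold nS
    have hiff : (∃ s ∈ S, s ∈ sC Γ D v (↑K : Set V)) ↔ (↑K : Set V) ∉ D0 := by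
      simp only [hD0, Set.mem_setOf_eq, Finset.mem_coe, Set.mem_singleton_iff, forall_eq, not_forall, not_not, exists_prop]
      refine exists_congr fun s => and_congr_right fun _ => ?_
      rw [mem_sC_comm, sC_coe_eq_siteCluster hK']
    by_cases h : ∃ s ∈ S, s ∈ sC Γ D v (↑K : Set V)
    · rw [ind_of_mem (show K ∈ {L : Finset V | ∃ s ∈ S, s ∈ sC Γ D v (↑L : Set V)} from h), ind_of_not_mem (hiff.1 h)]
      ring
    · rw [ind_of_not_mem (show K ∉ {L : Finset V | ∃ s ∈ S, s ∈ sC Γ D v (↑L : Set V)} from h),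
        ind_of_mem (show (↑K : Set V) ∈ D0 from not_not.1 fun h' => h (hiff.2 h'))]
      ring
  have hFx : ∀ K ∈ D.powerset, F (⋃ s ∈ (↑S : Set V), siteCluster Γ (↑K : Set V) s) = fS Γ D g x K := fun K hK => by
    simp only [hF, fS, SiteCSH.siteCluster_biUnion_eq Γ (↑S : Set V) (Finset.mem_coe.2 hxS),
      sC_coe_eq_siteCluster (Finset.mem_powerset.1 hK)]
  have hGx : ∀ K ∈ D.powerset, G (⋃ t ∈ ({v} : Set V), siteCluster Γ (↑K : Set V) t) = nS Γ D N v K := fun K hK => by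
    simp only [hG, Set.biUnion_singleton, nS, ind, Set.mem_setOf_eq, sC_coe_eq_siteCluster (Finset.mem_powerset.1 hK)]
  rw [measureReal_eq_ED, setIntegral_eq_ED, setIntegral_eq_ED, setIntegral_eq_ED, hED, hED, hED, hED] at key
  have e1 : ED D p (fun K => ind D0 (↑K : Set V)) = ED D p (fun K => 1 - nS Γ D S v K) := ED_congr_on D p hind
  have e2 : ED D p (fun K => ind D0 (↑K : Set V) *
      (F (⋃ s ∈ (↑S : Set V), siteCluster Γ (↑K : Set V) s) * G (⋃ t ∈ ({v} : Set V), siteCluster Γ (↑K : Set V) t))) =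
      ED D p (fun K => fS Γ D g x K * ((1 - nS Γ D S v K) * nS Γ D N v K)) :=
    ED_congr_on D p fun K hK => by rw [hind K hK, hFx K hK, hGx K hK]; ring
  have e3 : ED D p (fun K => ind D0 (↑K : Set V) * F (⋃ s ∈ (↑S : Set V), siteCluster Γ (↑K : Set V) s)) =
      ED D p (fun K => fS Γ D g x K * (1 - nS Γ D S v K)) :=
    ED_congr_on D p fun K hK => by rw [hind K hK, hFx K hK]; ring
  have e4 : ED D p (fun K => ind D0 (↑K : Set V) * G (⋃ t ∈ ({v} : Set V), siteCluster Γ (↑K : Set V) t)) =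
      ED D p (fun K => (1 - nS Γ D S v K) * nS Γ D N v K) :=
    ED_congr_on D p fun K hK => by rw [hind K hK, hGx K hK]
  rw [e1, e2, e3, e4] at key
  linarith

end SiteStarH

end Summit.CriticalPhenomena.PercolationContinuityZ3.Theorems.Transplant
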